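import Summits.AtomisticToContinuum.HydrodynamicLimit.Theorems.JaynesSqueezeHardSphereLDAFreeEnergyContinuous
import Summits.AtomisticToContinuum.HydrodynamicLimit.Theorems.JaynesSqueezeHardSphereLDAStability
import Summits.AtomisticToContinuum.HydrodynamicLimit.Theorems.JaynesSqueezeHardSphereLDAApprox
import HarnessLib

/-!
# Hard-sphere local density approximation, VII: the free energy at the thermodynamic activity (measurable profiles)

Helper file for the support item `HardSphereLDA` (stmt-AtomisticToContinuum-13459) of route
`JaynesSqueeze`: clause (B1) of the item for MEASURABLE density profiles (block-constant ones
included), `tendsto_freeEnergy_measurable`: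

  `(N+1)⁻¹ log Z_N(α_σ(ρ)) → ∫ ρ · ρσ³ f_ex′(ρσ³) dx`

for every measurable unit-mass `ρ` with `0 < c ≤ ρ` and `ρσ³ ≤ η_m`. Proof: measurable densities in
the band are `L¹`-limits of CONTINUOUS unit-mass densities in a band twice as wide
(`exists_continuous_approx`, file VIIa), for which file VI applies; the free energy per particle is `L¹`-Lipschitz in the
density uniformly in `N` (file Ic, `abs_log_posPartition_sub_le`, with the local chemical potential
`h_σ` Lipschitz on the band by file II), and so is the limit functional. No definitions.
prover-pitem-stmt-AtomisticToContinuum-13459-0.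
-/

noncomputable section

namespace Summit.AtomisticToContinuum.HydrodynamicLimit.Theorems.HardSphereLDA

open MeasureTheory Filter Set Topology
open scoped ENNReal BoundedContinuousFunction
open Literature.MathematicalPhysics.KineticTheory Literature.Analysis.FluidPDE
open Summit.AtomisticToContinuum.HydrodynamicLimit.Theorems.KineticWindowGronwallActivityInversion



section Core

variable {η₀ : ℝ} {F : ℝ → ℝ} (hη₀ : 0 < η₀) (hFa : AnalyticOnNhd ℝ F (Ioo (-η₀) η₀))
  (hEq : EqOn hsExcessFreeEnergy F (Ico 0 η₀))
  (hfree : ∀ η ∈ Ico 0 η₀, Tendsto (fun N : ℕ => -(N : ℝ)⁻¹ * Real.log (hsFreeVolume η N)) atTop (𝓝 (F η)))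
  {r : ℝ} {Rf : ℝ → ℝ} {η₂ : ℝ} (hr : 0 < r)
  (hsol : ∀ x ∈ Ioo (-r) r, 0 < Rf x ∧ Rf x * (∑' j : ℕ, bE j / (j.factorial : ℝ) * (x * Rf x) ^ j) = 1)
  (hbd : ∀ x ∈ Icc 0 r, 1 ≤ Rf x ∧ Rf x ≤ 2) (hcont : ContinuousOn Rf (Icc 0 r))
  (huniq : ∀ x ∈ Ioo (-r) r, ∀ R ∈ Icc (1 / 2 : ℝ) 2,
    R * (∑' j : ℕ, bE j / (j.factorial : ℝ) * (x * R) ^ j) = 1 → R = Rf x)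
  (hη₂ : 0 < η₂)
  (hexp : ∀ η ∈ Ioo 0 η₂, Real.exp (hsExcessFreeEnergy η + η * deriv hsExcessFreeEnergy η) = Rf η)
include hη₀ hFa hEq hfree hr hsol hbd hcont huniq hη₂ hexp

/-- **CLAUSE (B1) FOR MEASURABLE PROFILES.** Under `HsEosLowDensity` and the insertion-factor
package there is `η_m > 0` such that for all `σ > 0`, `c > 0` and all measurable unit-mass densities
`ρ` with `c ≤ ρ` and `ρσ³ ≤ η_m`: `(N+1)⁻¹ log Z_N(α_σ(ρ)) → ∫ ρ · ρσ³ f_ex′(ρσ³)`. [folklore] -/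
theorem tendsto_freeEnergy_measurable :
    ∃ ηm : ℝ, 0 < ηm ∧ ∀ σ : ℝ, 0 < σ → ∀ c : ℝ, 0 < c → ∀ ρ : T3 → ℝ, Measurable ρ → (∀ x, c ≤ ρ x) →
      (∫ x, ρ x) = 1 → (∀ x, ρ x * σ ^ 3 ≤ ηm) →
      Tendsto (fun N : ℕ => (((N + 1 : ℕ) : ℝ))⁻¹ *
          Real.log (posPartition (thermoActivity σ ρ) (hsDiameter σ N) (N + 1))) atTop
        (𝓝 (∫ x, ρ x * (ρ x * σ ^ 3 * deriv hsExcessFreeEnergy (ρ x * σ ^ 3)))) := by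
  obtain ⟨ηs, hηs0, hC⟩ := tendsto_freeEnergy_continuous hη₀ hFa hEq hfree hr hsol hbd hcont huniq hη₂ hexp
  obtain ⟨ηc, hηc0, hηcη₀, C, -, hcalc⟩ := eos_calculus hη₀ hFa hEq
  -- the threshold: half the continuous one, inside the calculus window and the window of `hexp`,
  -- and small against `v₁`
  set ηm : ℝ := min (min (ηs / 2) (ηc / 2)) (min (thresh r η₂ / 2) (1 / (32 * v₁))) with hηm
  have hv₁ := v₁_pos
  have hηm0 : 0 < ηm :=
    lt_min (lt_min (by positivity) (by positivity)) (lt_min (half_pos (thresh_pos hr hη₂)) (by positivity))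
  have hηm_s : 2 * ηm ≤ ηs := by
    have : ηm ≤ ηs / 2 := (min_le_left _ _).trans (min_le_left _ _); linarith
  have hηm_c : 2 * ηm ≤ ηc := by
    have : ηm ≤ ηc / 2 := (min_le_left _ _).trans (min_le_right _ _); linarith
  have hηm_T : 2 * ηm ≤ thresh r η₂ := by
    have : ηm ≤ thresh r η₂ / 2 := (min_le_right _ _).trans (min_le_left _ _); linarith
  have hηm_v : ηm ≤ 1 / (32 * v₁) := (min_le_right _ _).trans (min_le_right _ _)
  have hT2 : thresh r η₂ ≤ η₂ / 2 := (min_le_left _ _).trans (min_le_left _ _)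
  have hT16 : thresh r η₂ ≤ 1 / 16 := (min_le_left _ _).trans (min_le_right _ _)
  have hTr : thresh r η₂ ≤ r := by
    have h1 : thresh r η₂ ≤ r / (2 * (2 * (2 * Real.exp 1 + 1))) := (min_le_right _ _).trans (min_le_left _ _)
    have h2 : r / (2 * (2 * (2 * Real.exp 1 + 1))) ≤ r := by
      rw [div_le_iff₀ (by positivity)]
      have := Real.exp_pos 1
      nlinarith
    exact h1.trans h2
  have hTpos : 0 < thresh r η₂ := thresh_pos hr hη₂
  refine ⟨ηm, hηm0, fun σ hσ c hc ρ hρm hρlo hρ1 hpack => ?_⟩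
  have hσ3 : 0 < σ ^ 3 := pow_pos hσ 3
  obtain ⟨k, k₁, hk⟩ := hcalc σ hσ
  -- the band `[c/2, 2 ηm/σ³]` and the calculus on it
  set M : ℝ := ηm / σ ^ 3 with hM
  have hρM : ∀ x, ρ x ≤ M := fun x => by rw [hM, le_div_iff₀ hσ3]; exact hpack x
  have hρi : Integrable ρ := Integrable.of_bound hρm.aestronglyMeasurable M
    (Eventually.of_forall fun x => by rw [Real.norm_eq_abs, abs_of_pos (hc.trans_le (hρlo x))]; exact hρM x)
  set G : ℝ → ℝ := fun s => hsExcessFreeEnergy (s * σ ^ 3) + s * σ ^ 3 * deriv hsExcessFreeEnergy (s * σ ^ 3)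
    with hG
  set hg : ℝ → ℝ := fun s => Real.log s + G s with hhg
  set v : ℝ → ℝ := fun s => s * (s * σ ^ 3 * deriv hsExcessFreeEnergy (s * σ ^ 3)) with hv
  have hband : ∀ s ∈ Icc (c / 2) (2 * M), 0 < s ∧ s * σ ^ 3 ≤ ηc ∧ s * σ ^ 3 < η₂ ∧ s * σ ^ 3 ≤ thresh r η₂ := by
    intro s hs
    have hs0 : 0 < s := by linarith [hs.1]
    have h2 : s * σ ^ 3 ≤ 2 * ηm := by
      calc s * σ ^ 3 ≤ 2 * M * σ ^ 3 := by nlinarith [hs.2]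
        _ = 2 * ηm := by rw [hM]; field_simp
    refine ⟨hs0, h2.trans hηm_c, ?_, h2.trans hηm_T⟩
    calc s * σ ^ 3 ≤ 2 * ηm := h2
      _ ≤ thresh r η₂ := hηm_T
      _ < η₂ := by linarith
  have hderiv : ∀ s ∈ Icc (c / 2) (2 * M), HasDerivAt hg (k s) s ∧ HasDerivAt v (s * k s - 1) s ∧
      |k s| ≤ 3 / c ∧ |s * k s - 1| ≤ 5 / 2 ∧ HasDerivAt G (k s - 1 / s) s := by
    intro s hs
    obtain ⟨hs0, hsc, -, -⟩ := hband s hs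
    obtain ⟨-, -, hh, hklo, hkhi, -, -, hvd, -⟩ := hk s hs0 hsc
    have hkpos : 0 < k s := lt_of_lt_of_le (by positivity) hklo
    refine ⟨hh, hvd, ?_, ?_, ?_⟩
    · rw [abs_of_pos hkpos]
      calc k s ≤ 3 / (2 * s) := hkhi
        _ ≤ 3 / (2 * (c / 2)) := by gcongr; exact hs.1
        _ = 3 / c := by ring
    · have h1 : s * k s ≤ 3 / 2 := by
        calc s * k s ≤ s * (3 / (2 * s)) := by gcongr
          _ = 3 / 2 := by field_simp
      have h2 : 0 ≤ s * k s := by positivity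
      rw [abs_le]; constructor <;> linarith
    · -- `G = hg - log`
      have hlog : HasDerivAt Real.log (1 / s) s := by rw [one_div]; exact Real.hasDerivAt_log hs0.ne'
      refine (hh.sub hlog).congr_of_eventuallyEq (Eventually.of_forall fun t => ?_)
      show G t = (Real.log t + (hsExcessFreeEnergy (t * σ ^ 3) + t * σ ^ 3 *
          deriv hsExcessFreeEnergy (t * σ ^ 3))) - Real.log t
      rw [hG]; ring
  -- Lipschitz bounds on the band
  have hconv : Convex ℝ (Icc (c / 2) (2 * M)) := convex_Icc _ _
  have hlip_hg : ∀ s ∈ Icc (c / 2) (2 * M), ∀ t ∈ Icc (c / 2) (2 * M), |hg t - hg s| ≤ 3 / c * |t - s| := by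
    intro s hs t ht
    have h := hconv.norm_image_sub_le_of_norm_hasDerivWithin_le (f := hg) (f' := k) (C := 3 / c)
      (fun u hu => (hderiv u hu).1.hasDerivWithinAt) (fun u hu => by rw [Real.norm_eq_abs]; exact (hderiv u hu).2.2.1) hs ht
    rwa [Real.norm_eq_abs, Real.norm_eq_abs] at h
  have hlip_v : ∀ s ∈ Icc (c / 2) (2 * M), ∀ t ∈ Icc (c / 2) (2 * M), |v t - v s| ≤ 5 / 2 * |t - s| := by
    intro s hs t ht
    have h := hconv.norm_image_sub_le_of_norm_hasDerivWithin_le (f := v) (f' := fun u => u * k u - 1) (C := 5 / 2)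
      (fun u hu => (hderiv u hu).2.1.hasDerivWithinAt) (fun u hu => by rw [Real.norm_eq_abs]; exact (hderiv u hu).2.2.2.1) hs ht
    rwa [Real.norm_eq_abs, Real.norm_eq_abs] at h
  have hGcont : ContinuousOn G (Icc (c / 2) (2 * M)) := fun s hs => (hderiv s hs).2.2.2.2.continuousAt.continuousWithinAt
  -- the activity of a measurable / continuous density in the band: measurability and bounds
  have hact : ∀ ρ' : T3 → ℝ, Measurable ρ' → (∀ x, ρ' x ∈ Icc (c / 2) (2 * M)) →
      Measurable (thermoActivity σ ρ') ∧ (∀ x, 0 < thermoActivity σ ρ' x) ∧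
      (∀ x, ρ' x ≤ thermoActivity σ ρ' x) ∧ (∀ x, thermoActivity σ ρ' x ≤ 4 * M) := by
    intro ρ' hρ'm hmem
    have hrep : ∀ x, thermoActivity σ ρ' x = ρ' x * Rf (ρ' x * σ ^ 3) := by
      intro x
      obtain ⟨hs0, -, hs2, -⟩ := hband _ (hmem x)
      unfold thermoActivity
      rw [hexp _ ⟨mul_pos hs0 hσ3, hs2⟩]
    have hRf : ∀ x, 1 ≤ Rf (ρ' x * σ ^ 3) ∧ Rf (ρ' x * σ ^ 3) ≤ 2 := by
      intro x
      obtain ⟨hs0, -, -, hs3⟩ := hband _ (hmem x)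
      exact hbd _ ⟨(mul_pos hs0 hσ3).le, hs3.trans hTr⟩
    refine ⟨?_, fun x => ?_, fun x => ?_, fun x => ?_⟩
    · have h : thermoActivity σ ρ' = fun x => ρ' x * Real.exp (G (ρ' x)) := by
        funext x; unfold thermoActivity; rw [hG]
      rw [h]
      exact hρ'm.mul (Real.measurable_exp.comp (measurable_comp_of_continuousOn hGcont hρ'm hmem))
    · rw [hrep x]; exact mul_pos (hband _ (hmem x)).1 (by linarith [(hRf x).1])
    · rw [hrep x]; exact le_mul_of_one_le_right (hband _ (hmem x)).1.le (hRf x).1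
    · rw [hrep x]
      calc ρ' x * Rf (ρ' x * σ ^ 3) ≤ 2 * M * 2 :=
            mul_le_mul (hmem x).2 (hRf x).2 (by linarith [(hRf x).1]) (by linarith [(hmem x).1, (hmem x).2, hc])
        _ = 4 * M := by ring
  have hρmem : ∀ x, ρ x ∈ Icc (c / 2) (2 * M) := fun x =>
    ⟨by linarith [hρlo x], by linarith [hρM x, hc.trans_le ((hρlo x).trans (hρM x))]⟩
  have hM0 : 0 < M := hc.trans_le ((hρlo 0).trans (hρM 0))
  obtain ⟨haρm, haρ0, haρlo, haρhi⟩ := hact ρ hρm hρmem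
  -- `σ ≤ 1/2`
  obtain ⟨x₁, hx₁⟩ := exists_one_le_of_integral_eq_one' hρi hρ1
  have hσηm : σ ^ 3 ≤ ηm := by have := hpack x₁; nlinarith
  have hσ2 : σ < 1 / 2 := by
    have h16 : σ ^ 3 ≤ 1 / 16 := by linarith [hσηm, hηm_T, hT16]
    by_contra hcn
    push Not at hcn
    have : (1 / 2 : ℝ) ^ 3 ≤ σ ^ 3 := pow_le_pow_left₀ (by norm_num) hcn 3
    nlinarith
  -- the target functional
  set V : (T3 → ℝ) → ℝ := fun ρ' => ∫ x, v (ρ' x) with hV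
  ------------------------------------------------------------------
  -- the `e/3` argument
  ------------------------------------------------------------------
  rw [Metric.tendsto_atTop]
  intro e he
  -- the Lipschitz constant of `Λ_N` and `V` in the density
  set L : ℝ := 2 * (4 * M) * (3 / c) + 5 / 2 with hL
  have hL0 : 0 < L := by positivity
  obtain ⟨δ, hδ0, hδ2, hδe⟩ : ∃ δ : ℝ, 0 < δ ∧ δ ≤ 1 / 2 ∧ L * (2 * δ) < e / 3 := by
    refine ⟨min (1 / 2) (e / (12 * L)), lt_min (by norm_num) (by positivity), min_le_left _ _, ?_⟩
    calc L * (2 * min (1 / 2) (e / (12 * L))) ≤ L * (2 * (e / (12 * L))) := by gcongr; exact min_le_right _ _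
      _ = e / 6 := by field_simp; ring
      _ < e / 3 := by linarith
  obtain ⟨ρ', hρ'c, hρ'lo, hρ'hi, hρ'1, hρ'L1⟩ := exists_continuous_approx hρm hc hρlo hρM hρ1 hδ0 hδ2
  have hρ'mem : ∀ x, ρ' x ∈ Icc (c / 2) (2 * M) := fun x => ⟨hρ'lo x, hρ'hi x⟩
  have hρ'0 : ∀ x, 0 < ρ' x := fun x => (hband _ (hρ'mem x)).1
  have hρ'pack : ∀ x, ρ' x * σ ^ 3 ≤ ηs := fun x => by
    calc ρ' x * σ ^ 3 ≤ 2 * M * σ ^ 3 := by nlinarith [hρ'hi x]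
      _ = 2 * ηm := by rw [hM]; field_simp
      _ ≤ ηs := hηm_s
  obtain ⟨haρ'm, haρ'0, haρ'lo, haρ'hi⟩ := hact ρ' hρ'c.measurable hρ'mem
  -- (1) the continuous profile: eventually within `e/3`
  have hlimC := hC σ hσ ρ' hρ'c hρ'0 hρ'1 hρ'pack
  rw [Metric.tendsto_atTop] at hlimC
  obtain ⟨N₀, hN₀⟩ := hlimC (e / 3) (by positivity)
  refine ⟨N₀, fun N hN => ?_⟩
  have h1 := hN₀ N hN
  -- (2) the free energies at finite `N` are close, uniformly in `N`
  have hdiffψ : ∀ x, |Real.log (thermoActivity σ ρ' x) - Real.log (thermoActivity σ ρ x)| ≤ 3 / c * |ρ' x - ρ x| := by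
    intro x
    have e1 : ∀ ρ'' : T3 → ℝ, (0 < ρ'' x) → Real.log (thermoActivity σ ρ'' x) = hg (ρ'' x) := by
      intro ρ'' h0
      unfold thermoActivity
      rw [Real.log_mul h0.ne' (Real.exp_pos _).ne', Real.log_exp, hhg, hG]
    rw [e1 ρ' (hρ'0 x), e1 ρ (hc.trans_le (hρlo x))]
    exact hlip_hg _ (hρmem x) _ (hρ'mem x)
  have hB : ∀ x, |Real.log (thermoActivity σ ρ' x) - Real.log (thermoActivity σ ρ x)| ≤ 3 / c * (2 * M) := by
    intro x
    refine (hdiffψ x).trans (mul_le_mul_of_nonneg_left ?_ (by positivity))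
    rw [abs_le]; constructor <;> linarith [(hρmem x).1, (hρmem x).2, (hρ'mem x).1, (hρ'mem x).2]
  have hZ : 0 < posPartition (thermoActivity σ ρ) (hsDiameter σ N) (N + 1) :=
    posPartition_pos_of_ge haρm (half_pos hc) (fun y => (hρmem y).1.trans (haρlo y)) haρhi hσ2.le N
  have hZ' : 0 < posPartition (thermoActivity σ ρ') (hsDiameter σ N) (N + 1) :=
    posPartition_pos_of_ge haρ'm (half_pos hc) (fun y => (hρ'mem y).1.trans (haρ'lo y)) haρ'hi hσ2.le N
  have hε0 : 0 ≤ hsDiameter σ N := (hsDiameter_pos hσ N).le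
  have hε2 : hsDiameter σ N < 1 / 2 := (hsDiameter_le hσ.le N).trans_lt hσ2
  have hinta : 1 ≤ ∫ x, thermoActivity σ ρ x := by
    calc (1 : ℝ) = ∫ x, ρ x := hρ1.symm
      _ ≤ ∫ x, thermoActivity σ ρ x := integral_mono hρi (integrable_T3_of_abs_le haρm fun y => by
          rw [abs_of_pos (haρ0 y)]; exact haρhi y) haρlo
  have hinta' : 1 ≤ ∫ x, thermoActivity σ ρ' x := by
    calc (1 : ℝ) = ∫ x, ρ' x := hρ'1.symm
      _ ≤ ∫ x, thermoActivity σ ρ' x := integral_mono (integrable_of_continuous_T3 hρ'c)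
          (integrable_T3_of_abs_le haρ'm fun y => by rw [abs_of_pos (haρ'0 y)]; exact haρ'hi y) haρ'lo
  have hsmall : ((N + 1 : ℕ) : ℝ) * max (4 * M) (4 * M) * (v₁ * hsDiameter σ N ^ 3) ≤ 1 / 8 := by
    rw [max_self, hsDiameter_pow_three]
    have hN : (0 : ℝ) < ((N + 1 : ℕ) : ℝ) := by positivity
    have hMσ : M * σ ^ 3 = ηm := by rw [hM]; field_simp
    calc ((N + 1 : ℕ) : ℝ) * (4 * M) * (v₁ * (σ ^ 3 / ((N + 1 : ℕ) : ℝ)))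
        = 4 * v₁ * (M * σ ^ 3) * (((N + 1 : ℕ) : ℝ) / ((N + 1 : ℕ) : ℝ)) := by ring
      _ = 4 * v₁ * ηm := by rw [div_self hN.ne', hMσ, mul_one]
      _ ≤ 4 * v₁ * (1 / (32 * v₁)) := by gcongr
      _ = 1 / 8 := by field_simp; norm_num
  have hgap : ((N + 1 : ℕ) : ℝ) * max (4 * M) (4 * M) * (v₁ * hsDiameter σ N ^ 3) <
      min (∫ x, thermoActivity σ ρ x) (∫ x, thermoActivity σ ρ' x) :=
    lt_of_le_of_lt hsmall (lt_of_lt_of_le (by norm_num) (le_min hinta hinta'))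
  have hstab := abs_log_posPartition_sub_le (n := N + 1) haρm haρ'm haρ0 haρ'0 haρhi haρ'hi hB hε0 hε2 hZ hZ' hgap
  -- the `L¹`-distance of the fields
  have hfields : (∫ y, |Real.log (thermoActivity σ ρ' y) - Real.log (thermoActivity σ ρ y)|) ≤ 3 / c * (2 * δ) := by
    calc (∫ y, |Real.log (thermoActivity σ ρ' y) - Real.log (thermoActivity σ ρ y)|)
        ≤ ∫ y, 3 / c * |ρ' y - ρ y| := by
          refine integral_mono_of_nonneg (Eventually.of_forall fun y => abs_nonneg _)
            ((((integrable_of_continuous_T3 hρ'c).sub hρi).abs).const_mul _) (Eventually.of_forall hdiffψ)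
      _ ≤ 3 / c * (2 * δ) := by
          rw [integral_const_mul]
          exact mul_le_mul_of_nonneg_left hρ'L1 (by positivity)
  have h2 : |(((N + 1 : ℕ) : ℝ))⁻¹ * Real.log (posPartition (thermoActivity σ ρ') (hsDiameter σ N) (N + 1)) -
      (((N + 1 : ℕ) : ℝ))⁻¹ * Real.log (posPartition (thermoActivity σ ρ) (hsDiameter σ N) (N + 1))| ≤
      2 * (4 * M) * (3 / c) * (2 * δ) := by
    have hN : (0 : ℝ) < ((N + 1 : ℕ) : ℝ) := by positivity
    rw [← mul_sub, abs_mul, abs_inv, abs_of_pos hN, inv_mul_le_iff₀ hN]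
    refine hstab.trans ?_
    rw [max_self]
    have hden : 1 / 2 ≤ min (∫ x, thermoActivity σ ρ x) (∫ x, thermoActivity σ ρ' x) -
        ((N + 1 : ℕ) : ℝ) * (4 * M) * (v₁ * hsDiameter σ N ^ 3) := by
      rw [max_self] at hsmall
      linarith [le_min hinta hinta']
    calc ((N + 1 : ℕ) : ℝ) * (4 * M * (∫ y, |Real.log (thermoActivity σ ρ' y) - Real.log (thermoActivity σ ρ y)|) /
          (min (∫ x, thermoActivity σ ρ x) (∫ x, thermoActivity σ ρ' x) -
            ((N + 1 : ℕ) : ℝ) * (4 * M) * (v₁ * hsDiameter σ N ^ 3)))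
        ≤ ((N + 1 : ℕ) : ℝ) * (4 * M * (3 / c * (2 * δ)) / (1 / 2)) := by
          gcongr
      _ = ((N + 1 : ℕ) : ℝ) * (2 * (4 * M) * (3 / c) * (2 * δ)) := by ring
  -- (3) the limit functionals are close
  obtain ⟨Bv, hBv⟩ := (isCompact_Icc : IsCompact (Icc (c / 2) (2 * M))).exists_bound_of_continuousOn
    (fun s hs => (hderiv s hs).2.1.continuousAt.continuousWithinAt)
  have hvcont : ContinuousOn v (Icc (c / 2) (2 * M)) := fun s hs => (hderiv s hs).2.1.continuousAt.continuousWithinAt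
  have hvi : ∀ ρ'' : T3 → ℝ, Measurable ρ'' → (∀ x, ρ'' x ∈ Icc (c / 2) (2 * M)) → Integrable fun x => v (ρ'' x) :=
    fun ρ'' hm hmem => integrable_T3_of_abs_le (measurable_comp_of_continuousOn hvcont hm hmem)
      fun x => (Real.norm_eq_abs _).symm.le.trans (hBv _ (hmem x))
  have h3 : |(∫ x, v (ρ' x)) - ∫ x, v (ρ x)| ≤ 5 / 2 * (2 * δ) := by
    rw [← integral_sub (hvi ρ' hρ'c.measurable hρ'mem) (hvi ρ hρm hρmem)]
    refine (abs_integral_le_integral_abs).trans ?_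
    calc (∫ x, |v (ρ' x) - v (ρ x)|) ≤ ∫ x, 5 / 2 * |ρ' x - ρ x| :=
          integral_mono_of_nonneg (Eventually.of_forall fun x => abs_nonneg _)
            ((((integrable_of_continuous_T3 hρ'c).sub hρi).abs).const_mul _)
            (Eventually.of_forall fun x => hlip_v _ (hρmem x) _ (hρ'mem x))
      _ ≤ 5 / 2 * (2 * δ) := by
          rw [integral_const_mul]
          exact mul_le_mul_of_nonneg_left hρ'L1 (by positivity)
  -- combine
  rw [Real.dist_eq] at h1 ⊢
  have hv_def : ∀ ρ'' : T3 → ℝ, (∫ x, ρ'' x * (ρ'' x * σ ^ 3 * deriv hsExcessFreeEnergy (ρ'' x * σ ^ 3))) =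
      ∫ x, v (ρ'' x) := fun ρ'' => by rw [hv]
  rw [hv_def] at h1 ⊢
  have htri : |(((N + 1 : ℕ) : ℝ))⁻¹ * Real.log (posPartition (thermoActivity σ ρ) (hsDiameter σ N) (N + 1)) -
      ∫ x, v (ρ x)| ≤
      |(((N + 1 : ℕ) : ℝ))⁻¹ * Real.log (posPartition (thermoActivity σ ρ') (hsDiameter σ N) (N + 1)) -
        (((N + 1 : ℕ) : ℝ))⁻¹ * Real.log (posPartition (thermoActivity σ ρ) (hsDiameter σ N) (N + 1))| +
      |(((N + 1 : ℕ) : ℝ))⁻¹ * Real.log (posPartition (thermoActivity σ ρ') (hsDiameter σ N) (N + 1)) -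
        ∫ x, v (ρ' x)| + |(∫ x, v (ρ' x)) - ∫ x, v (ρ x)| := by
    set X := (((N + 1 : ℕ) : ℝ))⁻¹ * Real.log (posPartition (thermoActivity σ ρ) (hsDiameter σ N) (N + 1))
    set Y := (((N + 1 : ℕ) : ℝ))⁻¹ * Real.log (posPartition (thermoActivity σ ρ') (hsDiameter σ N) (N + 1))
    set U := ∫ x, v (ρ' x)
    set W := ∫ x, v (ρ x)
    calc |X - W| = |(-(Y - X) + (Y - U)) + (U - W)| := by ring_nf
      _ ≤ |-(Y - X) + (Y - U)| + |U - W| := abs_add_le _ _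
      _ ≤ (|-(Y - X)| + |Y - U|) + |U - W| := by gcongr; exact abs_add_le _ _
      _ = |Y - X| + |Y - U| + |U - W| := by rw [abs_neg]
  have hL2 : 2 * (4 * M) * (3 / c) * (2 * δ) + 5 / 2 * (2 * δ) = L * (2 * δ) := by rw [hL]; ring
  linarith [htri, h2, h1, h3, hδe, hL2]

end Core

end Summit.AtomisticToContinuum.HydrodynamicLimit.Theorems.HardSphereLDA

end
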